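import Summits.AtomisticToContinuum.Crystallization.Theorems.FrustratedLawDichotomyStrainedPatchHomSignedWell

/-!
# D-KAPPA: the ζ-centred near packaging with a CERTIFIED OPERATOR-NORM BOUND `κ` in place of `5/4`
# (27623 `(H) HomFloor`, hcp half, E-piece NEAR boxes; decomp-a2c hand-1 g48 — critic rows 1666 (C) «D-KAPPA wanted now», NEARGATE5-hand-1-g48 §3 (7))

`…HomSignedWell.hcpEnergy_of_ballLeaves_signed` turns the tube radius `r` into the diameter `D = (5/4)·r` through `‖U‖ ≤ 5/4` (from `‖U − 1‖ ≤ 1/4`).  On the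
E-zone boxes `‖U‖ ≈ 1.00` is certifiable per box (kernel: `…HomCurvCentreKitJoint.norm_apply_le_opHiJ`, Schur bound of the symmetric centre + Frobenius width,
HELD manifest v3; or any other supplier), and the slope / curvature charges of the near verdict scale like `D` / `D²` — NEAR-GATE-106's binding term is `G·D`.
This def-free edition threads an explicit `κ` with `‖U v‖ ≤ κ‖v‖` on the box:
* `norm_map_sub_le_of_ball_kappa` — `‖ξ − x‖ ≤ r ⟹ ‖U(ξ − x)‖ ≤ κ·r`;
* ★★★ `hcpEnergy_of_ballLeaves_kappa` — VERBATIM `hcpEnergy_of_ballLeaves_signed` with the extra hypothesis `hκ : ∀ U, Zb U → ∀ v, ‖U v‖ ≤ κ‖v‖` and the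
  conclusion `V₀ − G·(κr) + (min λ 0/2)(κr)² ≤ …` (so `κ = 5/4` recovers the landed statement; `κ = opHiJ/SC ≈ 1.00` saves 20 % of the slope charge and 36 % of the
  curvature charge).
Def-free; 0 sorry; standard axioms; no `set_option` / instances / notation / `#eval`.  `--supports stmt-AtomisticToContinuum-27623 --as helper`.
[folklore chaining: `hcpShifted_boxFloor_W45` + the operator-norm bound]
-/

noncomputable section

namespace Summit.AtomisticToContinuum.Crystallization.Theorems.FrustratedLawDichotomyStrainedPatchHomSignedWell

open scoped BigOperators
open Literature.Analysis.ValidatedNumerics.Numerics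
open Summit.AtomisticToContinuum.Crystallization.Theorems.ChargedEnergyGapNegative (E3)
open Summit.AtomisticToContinuum.Crystallization.Theorems.FrustratedLawDichotomySchurCut (effPot w₄₅ ω₄)
open Summit.AtomisticToContinuum.Crystallization.Theorems.FrustratedLawDichotomyStrainedPatchTaylorChord (segR segG segGd)
open Summit.AtomisticToContinuum.Crystallization.Theorems.FrustratedLawDichotomyStrainedPatchHomSplit (latPt hexFrame hcpShift)
open Summit.AtomisticToContinuum.Crystallization.Theorems.FrustratedLawDichotomyStrainedPatchEnvelopeTaylor (Wrec)
open Summit.AtomisticToContinuum.Crystallization.Theorems.FrustratedLawDichotomyStrainedPatchTaylorLeaves (junctions)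

/-- `‖ξ − x‖ ≤ r` and `‖U v‖ ≤ κ‖v‖` for all `v` ⟹ `‖U(ξ − x)‖ ≤ κ·r`. [folklore] -/
theorem norm_map_sub_le_of_ball_kappa {U : E3 →L[ℝ] E3} {κ : ℝ} (hκ : ∀ v : E3, ‖U v‖ ≤ κ * ‖v‖) {ξ x : E3} {r : ℝ}
    (hξ : ‖ξ - x‖ ≤ r) : ‖U (ξ - x)‖ ≤ κ * r := by
  have h0 : 0 ≤ κ := by
    have h3 := hκ (EuclideanSpace.single (0 : Fin 3) (1 : ℝ))
    have h4 : ‖(EuclideanSpace.single (0 : Fin 3) (1 : ℝ) : E3)‖ = 1 := by simp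
    rw [h4, mul_one] at h3
    exact (norm_nonneg _).trans h3
  exact (hκ _).trans (mul_le_mul_of_nonneg_left hξ h0)

/-- ★★★ **ζ-CENTRED UNIFORM PACKAGING WITH A CERTIFIED OPERATOR NORM** — `hcpEnergy_of_ballLeaves_signed` with `‖U v‖ ≤ κ‖v‖` on the box (`hκ`) replacing the
generic `‖U‖ ≤ 5/4`: for every `U ∈ Zb` with `‖U − 1‖ ≤ 1/4`, `‖σ U‖ ≤ 1/4` and every `ξ` with `‖ξ − σ U‖ ≤ r`, `‖ξ‖ ≤ 1/4`:
`V₀ − G·(κr) + (min λ 0/2)(κr)² ≤ SA U + Σ_b W₄₅‖latPt U hexFrame b + U(hcpShift + ξ)‖`. [folklore chaining: `hcpShifted_boxFloor_W45` + `norm_map_sub_le_of_ball_kappa`] -/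
theorem hcpEnergy_of_ballLeaves_kappa (B : Finset (Fin 3 → ℤ)) (Zb : (E3 →L[ℝ] E3) → Prop) (σ : (E3 →L[ℝ] E3) → E3) {r lam G V₀ κ : ℝ}
    (hG₀ : 0 ≤ G) (SA : (E3 →L[ℝ] E3) → ℝ)
    (hκ : ∀ U : E3 →L[ℝ] E3, Zb U → ∀ v : E3, ‖U v‖ ≤ κ * ‖v‖)
    (hval : ∀ U : E3 →L[ℝ] E3, Zb U → ‖U - 1‖ ≤ 1 / 4 → ‖σ U‖ ≤ 1 / 4 →
      V₀ ≤ SA U + ∑ b ∈ B, effPot w₄₅ ω₄ (3 / 400) ‖latPt U hexFrame b + U (hcpShift + σ U)‖)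
    (hslope : ∀ (U : E3 →L[ℝ] E3) (ξ : E3), Zb U → ‖U - 1‖ ≤ 1 / 4 → ‖σ U‖ ≤ 1 / 4 →
      |∑ b ∈ B, segG (deriv (effPot w₄₅ ω₄ (3 / 400))) (latPt U hexFrame b + U (hcpShift + σ U)) (U (ξ - σ U)) 0| ≤ G * ‖U (ξ - σ U)‖)
    (hcurv : ∀ (U : E3 →L[ℝ] E3) (ξ : E3), Zb U → ‖U - 1‖ ≤ 1 / 4 → ‖σ U‖ ≤ 1 / 4 → ‖ξ - σ U‖ ≤ r → ‖ξ‖ ≤ 1 / 4 →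
      ∀ s ∈ Set.Ioo (0 : ℝ) 1, (∀ b ∈ B, segR (latPt U hexFrame b + U (hcpShift + σ U)) (U (ξ - σ U)) s ∉ junctions) →
      lam * ‖U (ξ - σ U)‖ ^ 2 ≤ ∑ b ∈ B, segGd (deriv (effPot w₄₅ ω₄ (3 / 400))) (latPt U hexFrame b + U (hcpShift + σ U)) (U (ξ - σ U)) s)
    (U : E3 →L[ℝ] E3) (hZ : Zb U) (hU : ‖U - 1‖ ≤ 1 / 4) (hσ : ‖σ U‖ ≤ 1 / 4) (ξ : E3) (hξ : ‖ξ - σ U‖ ≤ r) (hn : ‖ξ‖ ≤ 1 / 4) :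
    V₀ - G * (κ * r) + min lam 0 / 2 * (κ * r) ^ 2 ≤ SA U + ∑ b ∈ B, effPot w₄₅ ω₄ (3 / 400) ‖latPt U hexFrame b + U (hcpShift + ξ)‖ := by
  have hV := hval U hZ hU hσ
  have hV' : V₀ - SA U ≤ ∑ b ∈ B, Wrec ‖latPt U hexFrame b + U (hcpShift + σ U)‖ := by
    unfold Wrec; linarith
  have hD := norm_map_sub_le_of_ball_kappa (hκ U hZ) hξ
  have key := hcpShifted_boxFloor_W45 B hU hσ hn hG₀ (hcurv U ξ hZ hU hσ hξ hn) hV' (hslope U ξ hZ hU hσ) hD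
  unfold Wrec at key
  linarith

end Summit.AtomisticToContinuum.Crystallization.Theorems.FrustratedLawDichotomyStrainedPatchHomSignedWell
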